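import Literature.NumberTheory.DiophantineGeometry.SchurWeylPlethysm
import Literature.Computability.AlgebraicComplexity.OrbitClosure
import HarnessLib

/-!
# Named fact: the multiplicity-obstruction principle of geometric complexity theory

Topic `Literature/Computability/AlgebraicComplexity`; grounds route item
`Summit.ValiantsHypothesis.ValiantsHypothesis.Theses.GCTMult.GctMultPrinciple`
(stmt-ValiantsHypothesis-0889) over the tree's `orbitMultiplicity` / `detFormLex` /
`paddedPerFormLex` (`SchurWeylPlethysm.lean`) and `orbitClosure` / `HasBorderDetRepr`
(`OrbitClosure.lean`).

**Bläser–Ikenmeyer, *Introduction to Geometric Complexity Theory*, Theory of Computing Graduate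
Surveys 10 (2025), §12.4 (p. 74).** "Let `Z₀ ⊆ Z` be a Zariski-closed cone that is closed under
the action of `GL_M`. Think of `\overline{GL_{n²} X₁₁^{n-m} per_m} ⊆ \overline{GL_{n²} det_n}`. Then
`I(Z)_δ ⊆ I(Z₀)_δ` and thus we obtain a canonical `GL`-equivariant surjection `ℂ[Z]_δ ↠ ℂ[Z₀]_δ`. By
Schur's lemma (Cor. 12.6) this implies `mult_λ(ℂ[Z]) ≥ mult_λ(ℂ[Z₀])`. Thus if we want to prove
`Z₀ ⊄ Z`, it is sufficient to show the existence of some `λ` that satisfies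
`mult_λ(ℂ[Z]) < mult_λ(ℂ[Z₀])`. Such `λ` are called representation theoretic multiplicity
obstructions." The same principle: Bürgisser–Landsberg–Manivel–Weyman, SIAM J. Comput. 40 (2011),
§1 ("Conjecture 1.1 is a straightforward consequence of Conjecture 1.2 by Schur's lemma");
Bürgisser–Ikenmeyer–Panova, J. AMS 32 (2019), §1.1; van den Berg–Dutta–Gesmundo–Ikenmeyer–Lysikov,
CCC 2025, §2.3 ("if `mult_λ ℂ[X] > mult_λ ℂ[Y]` for some `λ`, then `X ⊄ Y`").

Rendering. In the tree `Z = Δ_m[f]` is the orbit closure of a form `f` of degree `m` in the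
variables `σ` (linearly ordered, fixing the upper triangular Borel of `GL σ k`), with coordinate ring
`OrbitCoordRing f m` and `GL σ k`-action `orbitCoordRep f m`; `mult_χ` is
`orbitMultiplicity k f m χ = hwMultiplicity (orbitCoordRep f m) χ`, the dimension of the
`B`-semi-invariants of weight `χ` (= multiplicity of `V(χ)` by complete reducibility and
`hwMultiplicity_eq_finrank_intertwiningMap`; a weight pins the degree `δ`, so no degree index is
needed, `finiteDimensional_highestWeightSpace_orbitCoordRep`). `Z₀ ⊆ Z` for orbit closures of forms
is `g ∈ orbitClosure f` (then `Δ[g] ⊆ Δ[f]`, `orbitVanishingIdeal_le_of_mem_orbitClosure` in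
`GCTObstructions.lean`, where the surjection form `not_hasMultiplicityObstruction_of_mem_orbitClosure`
is PROVED). The numeric (highest-weight-multiplicity) form below additionally needs complete
reducibility of the degree pieces (characteristic zero, `isSemisimpleRepresentation_of_isRationalRep`)
so that the equivariant surjection splits and highest-weight spaces surject; it is therefore a
named fact. Hypotheses `m ≠ 0` and homogeneity restrict to the meaningful (non-junk) range of
`OrbitCoordRing`, exactly as in the sibling fact `orbitMultiplicity_le_plethysmCoeff`.

## References

* M. Bläser, C. Ikenmeyer, *Introduction to Geometric Complexity Theory*, Theory of Computing
  Graduate Surveys 10 (2025) 1–166, §12.4.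
* P. Bürgisser, J. M. Landsberg, L. Manivel, J. Weyman, *An overview of mathematical issues arising
  in the geometric complexity theory approach to VP ≠ VNP*, SIAM J. Comput. 40 (2011), §1.
* P. Bürgisser, C. Ikenmeyer, G. Panova, *No occurrence obstructions in geometric complexity
  theory*, J. Amer. Math. Soc. 32 (2019), §1.1.
* K. Mulmuley, M. Sohoni, *Geometric complexity theory II*, SIAM J. Comput. 38 (2008), §1–3.
-/

noncomputable section

open MvPolynomial

namespace Literature.Computability.AlgebraicComplexity

/-- NAMED FACT (**multiplicity-obstruction principle**; Bläser–Ikenmeyer 2025 §12.4, BLMW 2011 §1,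
BIP 2019 §1.1). In characteristic zero, for forms `f, g` of degree `m ≠ 0` with `g ∈ Δ[f]`
(`g ∈ orbitClosure f`, hence `Δ[g] ⊆ Δ[f]`), restriction `k[Δ_m[f]] ↠ k[Δ_m[g]]` is a
`GL σ k`-equivariant surjection of degreewise finite-dimensional completely reducible
representations, so for every highest weight `χ` the multiplicity in the smaller orbit closure is at
most that in the larger: `mult_χ k[Δ[g]] ≤ mult_χ k[Δ[f]]`. Contrapositive: a weight `χ` with
`mult_χ k[Δ[g]] > mult_χ k[Δ[f]]` (a *multiplicity obstruction*) proves `g ∉ Δ[f]`. Grounds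
`Summit.ValiantsHypothesis.ValiantsHypothesis.Theses.GCTMult.GctMultPrinciple` (with
`hasBorderDetRepr_iff_rename`, see `not_hasBorderDetRepr_of_orbitMultiplicity_lt`). Users take
`(h : orbitMultiplicity_le_of_mem_orbitClosure)`. [cite: BlaeserIkenmeyer2025, §12.4] -/
def orbitMultiplicity_le_of_mem_orbitClosure : Prop :=
  ∀ {k : Type} [Field k] [CharZero k] {σ : Type} [Fintype σ] [LinearOrder σ]
    (f g : MvPolynomial σ k) {m : ℕ} (_hm : m ≠ 0) (_hf : f.IsHomogeneous m)
    (_hg : g.IsHomogeneous m) (_h : g ∈ orbitClosure f) (χ : Literature.NumberTheory.DiophantineGeometry.Weight σ),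
    Literature.NumberTheory.DiophantineGeometry.orbitMultiplicity k g m χ ≤ Literature.NumberTheory.DiophantineGeometry.orbitMultiplicity k f m χ

/-- The principle in the shape the GCT route consumes (determinant versus padded permanent, weight
form, lexicographic Borel on `MatIdx m`): if some highest weight `χ` of `GL_{m²}` has strictly larger
multiplicity in `k[Δ(X₀₀^{m-n} per_n)]` than in `k[Δ(det_m)]`, then `X₀₀^{m-n} per_n ∉ Δ(det_m)`,
i.e. `¬ HasBorderDetRepr k n m`. From the two named facts
`orbitMultiplicity_le_of_mem_orbitClosure` and `hasBorderDetRepr_iff_rename` (transport to the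
lexicographically ordered variables) and the homogeneity of `detFormLex`, `paddedPerFormLex`
(`n ≤ m`). Bläser–Ikenmeyer 2025 §12.4; BLMW 2011 §1; BIP 2019 §1.1. [cite: BlaeserIkenmeyer2025, §12.4] -/
theorem not_hasBorderDetRepr_of_orbitMultiplicity_lt
    (h : orbitMultiplicity_le_of_mem_orbitClosure)
    {k : Type} [Field k] [CharZero k] (h' : @Literature.NumberTheory.DiophantineGeometry.hasBorderDetRepr_iff_rename k _)
    {n m : ℕ} [NeZero m] (hnm : n ≤ m) {χ : Literature.NumberTheory.DiophantineGeometry.Weight (Literature.NumberTheory.DiophantineGeometry.MatIdx m)}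
    (hlt : Literature.NumberTheory.DiophantineGeometry.orbitMultiplicity k (Literature.NumberTheory.DiophantineGeometry.detFormLex k m) m χ <
      Literature.NumberTheory.DiophantineGeometry.orbitMultiplicity k (Literature.NumberTheory.DiophantineGeometry.paddedPerFormLex k n m) m χ) :
    ¬ HasBorderDetRepr k n m := fun hmem =>
  (not_le.mpr hlt)
    (h _ _ (NeZero.ne m) (Literature.NumberTheory.DiophantineGeometry.detFormLex_isHomogeneous k m) (Literature.NumberTheory.DiophantineGeometry.paddedPerFormLex_isHomogeneous k hnm)
      ((h' n m).mp hmem) χ)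

end Literature.Computability.AlgebraicComplexity
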